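import Mathlib
import Summits.Ventures.PercRepro2.K5StarGenTablesA
import Summits.Ventures.PercRepro2.K5StarGenTablesB

/-!
# THE GENERAL-STAR CERTIFICATES, V: THE PRODUCTS ON THE LITERAL TABLES
(blind cell PercRepro2, mine-2 g41, 2026-08-29; `proofs/MINE2-GENSTAR.md` §4)

`posOn38L b` / `negOn38L b` are the swapped products of the crux kernel on the literal bit tables of
K5StarGenTablesA/B.lean (`posOn38L_eq`: they are `posOn38f` / `negOn38f` at the markings `b ∈ {4, 3, 0}`);
**`starNonnegGen_of_certL4 / L3 / L0`** are the certificate theorems on them (the ones the certificate files use).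
Own code; standard axioms.
-/

namespace Summit.Ventures.PercRepro2

open Hub

namespace K5

/-! ## The products on the literals -/

section Products

/-- The Kronecker number of a literal bit table through a bit mask. -/
def kronL (B m : ℕ) : ℕ := goI B m 10 0

/-- The positive products at `b = 4` on the literals, the third factors merged (7 products). -/
def posOn38L4 (m₁ m₂ m₃ : ℕ) : ℕ :=
  prod3 (kronL BtPD m₁) (kronL BtQ m₂) (kronL Bt4p_4 m₃ + kronL Bt6m_4 m₃) +
    prod3 (kronL BtQ m₁) (kronL BtPDoU m₂) (kronL Bt5p_4 m₃) +
    prod3 (kronL BtPD m₁) (kronL Bt7p_4 m₂) (kronL Bt7m_0 m₃ + kronL Bt10p m₃) +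
    prod3 (kronL BtPD m₁) (kronL Bt7m_4 m₂) (kronL Bt7p_0 m₃ + kronL Bt10m m₃) +
    prod3 (kronL BtPDoU m₁) (kronL Bt7p_4 m₂) (kronL Bt7m_3 m₃) +
    prod3 (kronL BtPDoU m₁) (kronL Bt7m_4 m₂) (kronL Bt7p_3 m₃) +
    prod3 (kronL BtQ m₁) (kronL Bt12_4 m₂) (kronL BtPDoU m₃)

/-- `posOn38L4` is `posOn38f 4`. -/
lemma posOn38L4_eq (m₁ m₂ m₃ : ℕ) : posOn38L4 m₁ m₂ m₃ = posOn38f 4 m₁ m₂ m₃ := by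
  unfold posOn38L4 posOn38f kronI kronL
  rw [Bt10m_eq, Bt10p_eq, Bt12_4_eq, Bt4p_4_eq, Bt5p_4_eq, Bt6m_4_eq, Bt7m_0_eq, Bt7m_3_eq, Bt7m_4_eq, Bt7p_0_eq, Bt7p_3_eq, Bt7p_4_eq, BtPD_eq, BtPDoU_eq, BtQ_eq]
  simp only [prod3_eq]
  ring

/-- The negative products at `b = 4` on the literals, the third factors merged (6 products). -/
def negOn38L4 (m₁ m₂ m₃ : ℕ) : ℕ :=
  prod3 (kronL BtPD m₁) (kronL BtQ m₂) (kronL Bt4m_4 m₃ + kronL Bt6p_4 m₃ + kronL Bt11_4 m₃) +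
    prod3 (kronL BtQ m₁) (kronL BtPDoU m₂) (kronL Bt5m_4 m₃) +
    prod3 (kronL BtPD m₁) (kronL Bt7p_4 m₂) (kronL Bt7p_0 m₃ + kronL Bt10m m₃) +
    prod3 (kronL BtPD m₁) (kronL Bt7m_4 m₂) (kronL Bt7m_0 m₃ + kronL Bt10p m₃) +
    prod3 (kronL BtPDoU m₁) (kronL Bt7p_4 m₂) (kronL Bt7p_3 m₃) +
    prod3 (kronL BtPDoU m₁) (kronL Bt7m_4 m₂) (kronL Bt7m_3 m₃)

/-- `negOn38L4` is `negOn38f 4`. -/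
lemma negOn38L4_eq (m₁ m₂ m₃ : ℕ) : negOn38L4 m₁ m₂ m₃ = negOn38f 4 m₁ m₂ m₃ := by
  unfold negOn38L4 negOn38f kronI kronL
  rw [Bt10m_eq, Bt10p_eq, Bt11_4_eq, Bt4m_4_eq, Bt5m_4_eq, Bt6p_4_eq, Bt7m_0_eq, Bt7m_3_eq, Bt7m_4_eq, Bt7p_0_eq, Bt7p_3_eq, Bt7p_4_eq, BtPD_eq, BtPDoU_eq, BtQ_eq]
  simp only [prod3_eq]
  ring

/-- The positive products at `b = 3` on the literals, the third factors merged (7 products). -/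
def posOn38L3 (m₁ m₂ m₃ : ℕ) : ℕ :=
  prod3 (kronL BtPD m₁) (kronL BtQ m₂) (kronL Bt4p_3 m₃ + kronL Bt6m_3 m₃) +
    prod3 (kronL BtQ m₁) (kronL BtPDoU m₂) (kronL Bt5p_3 m₃) +
    prod3 (kronL BtPD m₁) (kronL Bt7p_3 m₂) (kronL Bt7m_0 m₃ + kronL Bt10p m₃) +
    prod3 (kronL BtPD m₁) (kronL Bt7m_3 m₂) (kronL Bt7p_0 m₃ + kronL Bt10m m₃) +
    prod3 (kronL BtPDoU m₁) (kronL Bt7p_3 m₂) (kronL Bt7m_3 m₃) +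
    prod3 (kronL BtPDoU m₁) (kronL Bt7m_3 m₂) (kronL Bt7p_3 m₃) +
    prod3 (kronL BtQ m₁) (kronL Bt12_3 m₂) (kronL BtPDoU m₃)

/-- `posOn38L3` is `posOn38f 3`. -/
lemma posOn38L3_eq (m₁ m₂ m₃ : ℕ) : posOn38L3 m₁ m₂ m₃ = posOn38f 3 m₁ m₂ m₃ := by
  unfold posOn38L3 posOn38f kronI kronL
  rw [Bt10m_eq, Bt10p_eq, Bt12_3_eq, Bt4p_3_eq, Bt5p_3_eq, Bt6m_3_eq, Bt7m_0_eq, Bt7m_3_eq, Bt7p_0_eq, Bt7p_3_eq, BtPD_eq, BtPDoU_eq, BtQ_eq]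
  simp only [prod3_eq]
  ring

/-- The negative products at `b = 3` on the literals, the third factors merged (6 products). -/
def negOn38L3 (m₁ m₂ m₃ : ℕ) : ℕ :=
  prod3 (kronL BtPD m₁) (kronL BtQ m₂) (kronL Bt4m_3 m₃ + kronL Bt6p_3 m₃ + kronL Bt11_3 m₃) +
    prod3 (kronL BtQ m₁) (kronL BtPDoU m₂) (kronL Bt5m_3 m₃) +
    prod3 (kronL BtPD m₁) (kronL Bt7p_3 m₂) (kronL Bt7p_0 m₃ + kronL Bt10m m₃) +
    prod3 (kronL BtPD m₁) (kronL Bt7m_3 m₂) (kronL Bt7m_0 m₃ + kronL Bt10p m₃) +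
    prod3 (kronL BtPDoU m₁) (kronL Bt7p_3 m₂) (kronL Bt7p_3 m₃) +
    prod3 (kronL BtPDoU m₁) (kronL Bt7m_3 m₂) (kronL Bt7m_3 m₃)

/-- `negOn38L3` is `negOn38f 3`. -/
lemma negOn38L3_eq (m₁ m₂ m₃ : ℕ) : negOn38L3 m₁ m₂ m₃ = negOn38f 3 m₁ m₂ m₃ := by
  unfold negOn38L3 negOn38f kronI kronL
  rw [Bt10m_eq, Bt10p_eq, Bt11_3_eq, Bt4m_3_eq, Bt5m_3_eq, Bt6p_3_eq, Bt7m_0_eq, Bt7m_3_eq, Bt7p_0_eq, Bt7p_3_eq, BtPD_eq, BtPDoU_eq, BtQ_eq]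
  simp only [prod3_eq]
  ring

/-- The positive products at `b = 0` on the literals, the third factors merged (7 products). -/
def posOn38L0 (m₁ m₂ m₃ : ℕ) : ℕ :=
  prod3 (kronL BtPD m₁) (kronL BtQ m₂) (kronL Bt4p_0 m₃ + kronL Bt6m_0 m₃) +
    prod3 (kronL BtQ m₁) (kronL BtPDoU m₂) (kronL Bt5p_0 m₃) +
    prod3 (kronL BtPD m₁) (kronL Bt7p_0 m₂) (kronL Bt7m_0 m₃ + kronL Bt10p m₃) +
    prod3 (kronL BtPD m₁) (kronL Bt7m_0 m₂) (kronL Bt7p_0 m₃ + kronL Bt10m m₃) +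
    prod3 (kronL BtPDoU m₁) (kronL Bt7p_0 m₂) (kronL Bt7m_3 m₃) +
    prod3 (kronL BtPDoU m₁) (kronL Bt7m_0 m₂) (kronL Bt7p_3 m₃) +
    prod3 (kronL BtQ m₁) (kronL Bt12_0 m₂) (kronL BtPDoU m₃)

/-- `posOn38L0` is `posOn38f 0`. -/
lemma posOn38L0_eq (m₁ m₂ m₃ : ℕ) : posOn38L0 m₁ m₂ m₃ = posOn38f 0 m₁ m₂ m₃ := by
  unfold posOn38L0 posOn38f kronI kronL
  rw [Bt10m_eq, Bt10p_eq, Bt12_0_eq, Bt4p_0_eq, Bt5p_0_eq, Bt6m_0_eq, Bt7m_0_eq, Bt7m_3_eq, Bt7p_0_eq, Bt7p_3_eq, BtPD_eq, BtPDoU_eq, BtQ_eq]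
  simp only [prod3_eq]
  ring

/-- The negative products at `b = 0` on the literals, the third factors merged (6 products). -/
def negOn38L0 (m₁ m₂ m₃ : ℕ) : ℕ :=
  prod3 (kronL BtPD m₁) (kronL BtQ m₂) (kronL Bt4m_0 m₃ + kronL Bt6p_0 m₃ + kronL Bt11_0 m₃) +
    prod3 (kronL BtQ m₁) (kronL BtPDoU m₂) (kronL Bt5m_0 m₃) +
    prod3 (kronL BtPD m₁) (kronL Bt7p_0 m₂) (kronL Bt7p_0 m₃ + kronL Bt10m m₃) +
    prod3 (kronL BtPD m₁) (kronL Bt7m_0 m₂) (kronL Bt7m_0 m₃ + kronL Bt10p m₃) +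
    prod3 (kronL BtPDoU m₁) (kronL Bt7p_0 m₂) (kronL Bt7p_3 m₃) +
    prod3 (kronL BtPDoU m₁) (kronL Bt7m_0 m₂) (kronL Bt7m_3 m₃)

/-- `negOn38L0` is `negOn38f 0`. -/
lemma negOn38L0_eq (m₁ m₂ m₃ : ℕ) : negOn38L0 m₁ m₂ m₃ = negOn38f 0 m₁ m₂ m₃ := by
  unfold negOn38L0 negOn38f kronI kronL
  rw [Bt10m_eq, Bt10p_eq, Bt11_0_eq, Bt4m_0_eq, Bt5m_0_eq, Bt6p_0_eq, Bt7m_0_eq, Bt7m_3_eq, Bt7p_0_eq, Bt7p_3_eq, BtPD_eq, BtPDoU_eq, BtQ_eq]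
  simp only [prod3_eq]
  ring

/-- The certificate as a Boolean: `kNeg ≤ kPos` and the two mask tests. -/
def certB (kNeg kPos : ℕ) : Bool :=
  (kNeg ≤ kPos : Bool) && (Nat.land (kPos - kNeg) mask8 == 0) && (Nat.land kNeg mask8 == 0)

/-- `certB` decides `CertLE8`. -/
lemma certLE8_of_certB {kNeg kPos : ℕ} (h : certB kNeg kPos = true) : CertLE8 kNeg kPos := by
  unfold certB at h
  simp only [Bool.and_eq_true, decide_eq_true_eq, beq_iff_eq] at h
  exact ⟨h.1.1, h.1.2, h.2⟩

/-- `sumLI` respects pointwise equality. -/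
lemma sumLI_congr (f g : ℕ → ℕ → ℕ → ℕ) (h : ∀ a b c, f a b c = g a b c) :
    ∀ ms : List (ℕ × ℕ × ℕ), sumLI f ms = sumLI g ms
  | [] => rfl
  | t :: ms => by rw [sumLI, sumLI, h, sumLI_congr f g h ms]

variable {R : Type*} [Field R] [LinearOrder R] [IsStrictOrderedRing R]

/-- **`StarNonnegGen` at `b = 4` from one certificate on the literal tables.** -/
theorem starNonnegGen_of_certL4 (L : List (Fin 5 × ℕ)) (ms : List Mask3) (msI : List (ℕ × ℕ × ℕ))
    (hms : ((placeList L ∅ ∅ ∅).map cmask3).filter alive = ms) (hmsI : ms.map swIdx = msI)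
    (hlen : ms.length ≤ 454) (hc : CertLE8 (sumLI negOn38L4 msI) (sumLI posOn38L4 msI)) :
    StarNonnegGen R 0 1 2 3 4 L := by
  refine starNonnegGen_of_certI 4 4 rfl L ms msI hms hmsI hlen ?_
  rwa [sumLI_congr _ _ (negOn38L4_eq), sumLI_congr _ _ (posOn38L4_eq)] at hc

/-- **`StarNonnegGen` at `b = 3` from one certificate on the literal tables.** -/
theorem starNonnegGen_of_certL3 (L : List (Fin 5 × ℕ)) (ms : List Mask3) (msI : List (ℕ × ℕ × ℕ))
    (hms : ((placeList L ∅ ∅ ∅).map cmask3).filter alive = ms) (hmsI : ms.map swIdx = msI)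
    (hlen : ms.length ≤ 454) (hc : CertLE8 (sumLI negOn38L3 msI) (sumLI posOn38L3 msI)) :
    StarNonnegGen R 0 1 2 3 3 L := by
  refine starNonnegGen_of_certI 3 3 rfl L ms msI hms hmsI hlen ?_
  rwa [sumLI_congr _ _ (negOn38L3_eq), sumLI_congr _ _ (posOn38L3_eq)] at hc

/-- **`StarNonnegGen` at `b = 0` from one certificate on the literal tables.** -/
theorem starNonnegGen_of_certL0 (L : List (Fin 5 × ℕ)) (ms : List Mask3) (msI : List (ℕ × ℕ × ℕ))
    (hms : ((placeList L ∅ ∅ ∅).map cmask3).filter alive = ms) (hmsI : ms.map swIdx = msI)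
    (hlen : ms.length ≤ 454) (hc : CertLE8 (sumLI negOn38L0 msI) (sumLI posOn38L0 msI)) :
    StarNonnegGen R 0 1 2 3 0 L := by
  refine starNonnegGen_of_certI 0 0 rfl L ms msI hms hmsI hlen ?_
  rwa [sumLI_congr _ _ (negOn38L0_eq), sumLI_congr _ _ (posOn38L0_eq)] at hc

end Products

end K5

end Summit.Ventures.PercRepro2
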